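import Summits.CriticalPhenomena.PercolationContinuityZ3.Theorems.PercNearOneGluingNoHeavyLowerTailFrontierDecRowsClusterMarkovCore
import Summits.CriticalPhenomena.PercolationContinuityZ3.Theorems.PercNearOneGluingNoHeavyLowerTailFrontierDecRowsLeFive
import Summits.CriticalPhenomena.PercolationContinuityZ3.Theorems.PercNearOneGluingNoHeavyLowerTailGroupThreePointLBRows
import HarnessLib

/-!
# The four-point decreasing cubic frontier: 29 of the 45 essential `E₃` rows (27 of the 37 rows NOT implied by the proved cubic
# families) hold on EVERY finite weighted graph — corollaries of the cluster-Markov / BHK criterion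

Support file (prover prim-l12-p1 gen 2, P1 line; `--supports stmt-CriticalPhenomena-4575`).  No definitions, no named facts, no
sorries, no `native_decide`.

`…FrontierDecRowsLeFive` (prim-bnk-1) certifies the 45 essential `S₄`-orbits of decreasing four-point `E₃` rows (`row i`, `i : Fin 45`)
for `n ≤ 5` and records that the all-`n` statements of the 37 orbits not implied by {F, group/hybrid 3PT-LB, GR3} + Harris
(prim-masterthm-p1 FRONTIER-4PT.md) were open.  The criterion of `…FrontierDecRowsClusterMarkovCore`
(`ClusterMarkovE3.sahiE3_sep_notReach_sep_nonneg`: `E₃(D[P|Q], {s ↮ X}, D[P'|Q']) ≥ 0` whenever `Q, Q' ⊆ X`) applies to a row iff one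
of its three events has a singleton side `{s}` (with other side `X`) and each of the two remaining events has a side inside `X`.
This holds for the 29 rows
  `0 1 2 3 4 5 6 7 9 10 13 14 17 18 20 21 22 23 24 25 26 28 29 34 35 38 39 41 42`
(all `n`, all weights, all `a b c y`, no distinctness needed), of which `9` and `17` were already cone-implied; row `42` (the STAR) is
`…FrontierDecRowsOneSource.frontier_42_all` and is not repeated here (28 theorems below).  NOT covered by the criterion (still open for general `n`, census-clean, `n ≤ 5` by kernel):
rows `8 11 12 15 16 19 27 30 31 32 33 36 37 40 43 44` minus the cone-implied ones among them — i.e. the ten unimplied orbits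
`(D[ab|c],D[ac|by],D[ay|b])`, `(D[ab|c],D[ac|by],D[b|y])`, `(D[ab|c],D[ac|y],D[b|y])`, `(D[ab|c],D[ab|y],D[ac|by])`, `(D[ab|c],D[ac|by],D[b|cy])`,
`(D[ab|c],D[ac|y],D[bc|y])`, `(D[ab|c],D[a|b],D[c|y])`, `(D[a|b],D[a|c],D[b|y])` (the PATH), `(D[ab|c],D[ac|y],D[ay|b])`, `(D[ab|cy],D[a|b],D[c|y])`.
-/

noncomputable section

namespace Summit.CriticalPhenomena.PercolationContinuityZ3.Theorems.FrontierDecRows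

open MeasureTheory CovTransferCert E3GroupSepCert HybridRows ClusterMarkovE3
open Literature.Probability.Percolation Literature.Probability.LatticeModels

variable {n : ℕ}

/-- `connEvent (sep P Q)` in the `Reachable` set-builder form of `…ClusterMarkovCore`. [folklore] -/
theorem connEvent_sep_eq_setOf (P Q : List (Fin n)) :
    connEvent (sep P Q) =
      {ω : BondConfig (Fin n) | ∀ p ∈ ({v | v ∈ P} : Set (Fin n)), ∀ q ∈ ({v | v ∈ Q} : Set (Fin n)),
        ¬ (openGraph ω).Reachable p q} := by
  rw [connEvent_sep]
  ext ω
  simp only [Set.mem_setOf_eq, openConn]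

/-- **The criterion in the `sep` vocabulary**: `0 ≤ E₃(D[P|Q], D[s|X], D[P'|Q'])` whenever `Q ⊆ X` and `Q' ⊆ X` (lists of terminals,
all `n`). [this work] -/
theorem sep_crit (w : Sym2 (Fin n) → unitInterval) (s : Fin n) (X P Q P' Q' : List (Fin n))
    (hQ : ∀ q ∈ Q, q ∈ X) (hQ' : ∀ q ∈ Q', q ∈ X) :
    0 ≤ sahiE3 (prodBernoulli w) (connEvent (sep P Q)) (connEvent (sep [s] X)) (connEvent (sep P' Q')) := by
  rw [connEvent_sep_eq_setOf P Q, connEvent_sep_eq_setOf [s] X, connEvent_sep_eq_setOf P' Q']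
  have hs : ({v | v ∈ [s]} : Set (Fin n)) = {s} := by ext v; simp
  rw [hs]
  exact sahiE3_sep_notReach_sep_nonneg w s {v | v ∈ X} {v | v ∈ P} {v | v ∈ Q} {v | v ∈ P'} {v | v ∈ Q'}
    (fun q hq => hQ q hq) (fun q hq => hQ' q hq)

/-- Row `0` = `(D[abc|y], D[aby|c], D[ac|b])` on EVERY finite weighted graph (criterion: middle `{y ↮ abc}`). [this work] -/
theorem frontier_0_all (w : Sym2 (Fin n) → unitInterval) (a b c y : Fin n) :
    0 ≤ sahiE3 (prodBernoulli w) (connEvent (row 0 n (a, b, c, y)).1) (connEvent (row 0 n (a, b, c, y)).2.1)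
      (connEvent (row 0 n (a, b, c, y)).2.2) := by
  have hr : row 0 n (a, b, c, y) = (sep [a, b, c] [y], sep [a, b, y] [c], sep [a, c] [b]) := rfl
  rw [hr]
  rw [sahiE3_comm₁₂]
  rw [connEvent_sep_comm [a, b, c] [y]]
  exact sep_crit w y [a, b, c] [a, b, y] [c] [a, c] [b] (by simp) (by simp)

/-- Row `1` = `(D[abc|y], D[ab|c], D[ac|by])` on EVERY finite weighted graph (criterion: middle `{y ↮ abc}`). [this work] -/
theorem frontier_1_all (w : Sym2 (Fin n) → unitInterval) (a b c y : Fin n) :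
    0 ≤ sahiE3 (prodBernoulli w) (connEvent (row 1 n (a, b, c, y)).1) (connEvent (row 1 n (a, b, c, y)).2.1)
      (connEvent (row 1 n (a, b, c, y)).2.2) := by
  have hr : row 1 n (a, b, c, y) = (sep [a, b, c] [y], sep [a, b] [c], sep [a, c] [b, y]) := rfl
  rw [hr]
  rw [sahiE3_comm₁₂]
  rw [connEvent_sep_comm [a, b, c] [y]]
  rw [connEvent_sep_comm [a, c] [b, y]]
  exact sep_crit w y [a, b, c] [a, b] [c] [b, y] [a, c] (by simp) (by simp)

/-- Row `2` = `(D[abc|y], D[ab|c], D[ay|b])` on EVERY finite weighted graph (criterion: middle `{y ↮ abc}`). [this work] -/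
theorem frontier_2_all (w : Sym2 (Fin n) → unitInterval) (a b c y : Fin n) :
    0 ≤ sahiE3 (prodBernoulli w) (connEvent (row 2 n (a, b, c, y)).1) (connEvent (row 2 n (a, b, c, y)).2.1)
      (connEvent (row 2 n (a, b, c, y)).2.2) := by
  have hr : row 2 n (a, b, c, y) = (sep [a, b, c] [y], sep [a, b] [c], sep [a, y] [b]) := rfl
  rw [hr]
  rw [sahiE3_comm₁₂]
  rw [connEvent_sep_comm [a, b, c] [y]]
  exact sep_crit w y [a, b, c] [a, b] [c] [a, y] [b] (by simp) (by simp)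

/-- Row `3` = `(D[abc|y], D[ab|cy], D[ay|b])` on EVERY finite weighted graph (criterion: middle `{y ↮ abc}`). [this work] -/
theorem frontier_3_all (w : Sym2 (Fin n) → unitInterval) (a b c y : Fin n) :
    0 ≤ sahiE3 (prodBernoulli w) (connEvent (row 3 n (a, b, c, y)).1) (connEvent (row 3 n (a, b, c, y)).2.1)
      (connEvent (row 3 n (a, b, c, y)).2.2) := by
  have hr : row 3 n (a, b, c, y) = (sep [a, b, c] [y], sep [a, b] [c, y], sep [a, y] [b]) := rfl
  rw [hr]
  rw [sahiE3_comm₁₂]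
  rw [connEvent_sep_comm [a, b, c] [y]]
  rw [connEvent_sep_comm [a, b] [c, y]]
  exact sep_crit w y [a, b, c] [c, y] [a, b] [a, y] [b] (by simp) (by simp)

/-- Row `4` = `(D[abc|y], D[ay|b], D[a|c])` on EVERY finite weighted graph (criterion: middle `{y ↮ abc}`). [this work] -/
theorem frontier_4_all (w : Sym2 (Fin n) → unitInterval) (a b c y : Fin n) :
    0 ≤ sahiE3 (prodBernoulli w) (connEvent (row 4 n (a, b, c, y)).1) (connEvent (row 4 n (a, b, c, y)).2.1)
      (connEvent (row 4 n (a, b, c, y)).2.2) := by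
  have hr : row 4 n (a, b, c, y) = (sep [a, b, c] [y], sep [a, y] [b], sep [a] [c]) := rfl
  rw [hr]
  rw [sahiE3_comm₁₂]
  rw [connEvent_sep_comm [a, b, c] [y]]
  exact sep_crit w y [a, b, c] [a, y] [b] [a] [c] (by simp) (by simp)

/-- Row `5` = `(D[abc|y], D[ay|b], D[a|cy])` on EVERY finite weighted graph (criterion: middle `{y ↮ abc}`). [this work] -/
theorem frontier_5_all (w : Sym2 (Fin n) → unitInterval) (a b c y : Fin n) :
    0 ≤ sahiE3 (prodBernoulli w) (connEvent (row 5 n (a, b, c, y)).1) (connEvent (row 5 n (a, b, c, y)).2.1)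
      (connEvent (row 5 n (a, b, c, y)).2.2) := by
  have hr : row 5 n (a, b, c, y) = (sep [a, b, c] [y], sep [a, y] [b], sep [a] [c, y]) := rfl
  rw [hr]
  rw [sahiE3_comm₁₂]
  rw [connEvent_sep_comm [a, b, c] [y]]
  rw [connEvent_sep_comm [a] [c, y]]
  exact sep_crit w y [a, b, c] [a, y] [b] [c, y] [a] (by simp) (by simp)

/-- Row `6` = `(D[abc|y], D[ay|b], D[b|c])` on EVERY finite weighted graph (criterion: middle `{y ↮ abc}`). [this work] -/
theorem frontier_6_all (w : Sym2 (Fin n) → unitInterval) (a b c y : Fin n) :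
    0 ≤ sahiE3 (prodBernoulli w) (connEvent (row 6 n (a, b, c, y)).1) (connEvent (row 6 n (a, b, c, y)).2.1)
      (connEvent (row 6 n (a, b, c, y)).2.2) := by
  have hr : row 6 n (a, b, c, y) = (sep [a, b, c] [y], sep [a, y] [b], sep [b] [c]) := rfl
  rw [hr]
  rw [sahiE3_comm₁₂]
  rw [connEvent_sep_comm [a, b, c] [y]]
  exact sep_crit w y [a, b, c] [a, y] [b] [b] [c] (by simp) (by simp)

/-- Row `7` = `(D[ab|c], D[ab|y], D[ac|b])` on EVERY finite weighted graph (criterion: middle `{c ↮ ab}`). [this work] -/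
theorem frontier_7_all (w : Sym2 (Fin n) → unitInterval) (a b c y : Fin n) :
    0 ≤ sahiE3 (prodBernoulli w) (connEvent (row 7 n (a, b, c, y)).1) (connEvent (row 7 n (a, b, c, y)).2.1)
      (connEvent (row 7 n (a, b, c, y)).2.2) := by
  have hr : row 7 n (a, b, c, y) = (sep [a, b] [c], sep [a, b] [y], sep [a, c] [b]) := rfl
  rw [hr]
  rw [sahiE3_comm₁₂]
  rw [connEvent_sep_comm [a, b] [c]]
  rw [connEvent_sep_comm [a, b] [y]]
  exact sep_crit w c [a, b] [y] [a, b] [a, c] [b] (by simp) (by simp)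

/-- Row `9` = `(D[ab|c], D[ac|b], D[by|c])` on EVERY finite weighted graph (criterion: middle `{b ↮ ac}`). [this work] -/
theorem frontier_9_all (w : Sym2 (Fin n) → unitInterval) (a b c y : Fin n) :
    0 ≤ sahiE3 (prodBernoulli w) (connEvent (row 9 n (a, b, c, y)).1) (connEvent (row 9 n (a, b, c, y)).2.1)
      (connEvent (row 9 n (a, b, c, y)).2.2) := by
  have hr : row 9 n (a, b, c, y) = (sep [a, b] [c], sep [a, c] [b], sep [b, y] [c]) := rfl
  rw [hr]
  rw [connEvent_sep_comm [a, c] [b]]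
  exact sep_crit w b [a, c] [a, b] [c] [b, y] [c] (by simp) (by simp)

/-- Row `10` = `(D[ab|c], D[ac|b], D[b|y])` on EVERY finite weighted graph (criterion: middle `{c ↮ ab}`). [this work] -/
theorem frontier_10_all (w : Sym2 (Fin n) → unitInterval) (a b c y : Fin n) :
    0 ≤ sahiE3 (prodBernoulli w) (connEvent (row 10 n (a, b, c, y)).1) (connEvent (row 10 n (a, b, c, y)).2.1)
      (connEvent (row 10 n (a, b, c, y)).2.2) := by
  have hr : row 10 n (a, b, c, y) = (sep [a, b] [c], sep [a, c] [b], sep [b] [y]) := rfl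
  rw [hr]
  rw [sahiE3_comm₁₂]
  rw [connEvent_sep_comm [a, b] [c]]
  rw [connEvent_sep_comm [b] [y]]
  exact sep_crit w c [a, b] [a, c] [b] [y] [b] (by simp) (by simp)

/-- Row `13` = `(D[ab|c], D[ac|y], D[a|b])` on EVERY finite weighted graph (criterion: middle `{y ↮ ac}`). [this work] -/
theorem frontier_13_all (w : Sym2 (Fin n) → unitInterval) (a b c y : Fin n) :
    0 ≤ sahiE3 (prodBernoulli w) (connEvent (row 13 n (a, b, c, y)).1) (connEvent (row 13 n (a, b, c, y)).2.1)
      (connEvent (row 13 n (a, b, c, y)).2.2) := by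
  have hr : row 13 n (a, b, c, y) = (sep [a, b] [c], sep [a, c] [y], sep [a] [b]) := rfl
  rw [hr]
  rw [connEvent_sep_comm [a, c] [y]]
  rw [connEvent_sep_comm [a] [b]]
  exact sep_crit w y [a, c] [a, b] [c] [b] [a] (by simp) (by simp)

/-- Row `14` = `(D[ab|c], D[ac|y], D[a|by])` on EVERY finite weighted graph (criterion: middle `{y ↮ ac}`). [this work] -/
theorem frontier_14_all (w : Sym2 (Fin n) → unitInterval) (a b c y : Fin n) :
    0 ≤ sahiE3 (prodBernoulli w) (connEvent (row 14 n (a, b, c, y)).1) (connEvent (row 14 n (a, b, c, y)).2.1)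
      (connEvent (row 14 n (a, b, c, y)).2.2) := by
  have hr : row 14 n (a, b, c, y) = (sep [a, b] [c], sep [a, c] [y], sep [a] [b, y]) := rfl
  rw [hr]
  rw [connEvent_sep_comm [a, c] [y]]
  rw [connEvent_sep_comm [a] [b, y]]
  exact sep_crit w y [a, c] [a, b] [c] [b, y] [a] (by simp) (by simp)

/-- Row `17` = `(D[ab|c], D[a|b], D[a|cy])` on EVERY finite weighted graph (criterion: middle `{c ↮ ab}`). [this work] -/
theorem frontier_17_all (w : Sym2 (Fin n) → unitInterval) (a b c y : Fin n) :
    0 ≤ sahiE3 (prodBernoulli w) (connEvent (row 17 n (a, b, c, y)).1) (connEvent (row 17 n (a, b, c, y)).2.1)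
      (connEvent (row 17 n (a, b, c, y)).2.2) := by
  have hr : row 17 n (a, b, c, y) = (sep [a, b] [c], sep [a] [b], sep [a] [c, y]) := rfl
  rw [hr]
  rw [sahiE3_comm₁₂]
  rw [connEvent_sep_comm [a, b] [c]]
  rw [connEvent_sep_comm [a] [c, y]]
  exact sep_crit w c [a, b] [a] [b] [c, y] [a] (by simp) (by simp)

/-- Row `18` = `(D[ab|c], D[a|b], D[a|y])` on EVERY finite weighted graph (criterion: middle `{c ↮ ab}`). [this work] -/
theorem frontier_18_all (w : Sym2 (Fin n) → unitInterval) (a b c y : Fin n) :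
    0 ≤ sahiE3 (prodBernoulli w) (connEvent (row 18 n (a, b, c, y)).1) (connEvent (row 18 n (a, b, c, y)).2.1)
      (connEvent (row 18 n (a, b, c, y)).2.2) := by
  have hr : row 18 n (a, b, c, y) = (sep [a, b] [c], sep [a] [b], sep [a] [y]) := rfl
  rw [hr]
  rw [sahiE3_comm₁₂]
  rw [connEvent_sep_comm [a, b] [c]]
  rw [connEvent_sep_comm [a] [y]]
  exact sep_crit w c [a, b] [a] [b] [y] [a] (by simp) (by simp)

/-- Row `20` = `(D[abc|y], D[aby|c], D[ac|by])` on EVERY finite weighted graph (criterion: middle `{y ↮ abc}`). [this work] -/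
theorem frontier_20_all (w : Sym2 (Fin n) → unitInterval) (a b c y : Fin n) :
    0 ≤ sahiE3 (prodBernoulli w) (connEvent (row 20 n (a, b, c, y)).1) (connEvent (row 20 n (a, b, c, y)).2.1)
      (connEvent (row 20 n (a, b, c, y)).2.2) := by
  have hr : row 20 n (a, b, c, y) = (sep [a, b, c] [y], sep [a, b, y] [c], sep [a, c] [b, y]) := rfl
  rw [hr]
  rw [sahiE3_comm₁₂]
  rw [connEvent_sep_comm [a, b, c] [y]]
  rw [connEvent_sep_comm [a, c] [b, y]]
  exact sep_crit w y [a, b, c] [a, b, y] [c] [b, y] [a, c] (by simp) (by simp)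

/-- Row `21` = `(D[abc|y], D[ab|c], D[ac|b])` on EVERY finite weighted graph (criterion: middle `{y ↮ abc}`). [this work] -/
theorem frontier_21_all (w : Sym2 (Fin n) → unitInterval) (a b c y : Fin n) :
    0 ≤ sahiE3 (prodBernoulli w) (connEvent (row 21 n (a, b, c, y)).1) (connEvent (row 21 n (a, b, c, y)).2.1)
      (connEvent (row 21 n (a, b, c, y)).2.2) := by
  have hr : row 21 n (a, b, c, y) = (sep [a, b, c] [y], sep [a, b] [c], sep [a, c] [b]) := rfl
  rw [hr]
  rw [sahiE3_comm₁₂]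
  rw [connEvent_sep_comm [a, b, c] [y]]
  exact sep_crit w y [a, b, c] [a, b] [c] [a, c] [b] (by simp) (by simp)

/-- Row `22` = `(D[abc|y], D[ab|c], D[a|b])` on EVERY finite weighted graph (criterion: middle `{y ↮ abc}`). [this work] -/
theorem frontier_22_all (w : Sym2 (Fin n) → unitInterval) (a b c y : Fin n) :
    0 ≤ sahiE3 (prodBernoulli w) (connEvent (row 22 n (a, b, c, y)).1) (connEvent (row 22 n (a, b, c, y)).2.1)
      (connEvent (row 22 n (a, b, c, y)).2.2) := by
  have hr : row 22 n (a, b, c, y) = (sep [a, b, c] [y], sep [a, b] [c], sep [a] [b]) := rfl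
  rw [hr]
  rw [sahiE3_comm₁₂]
  rw [connEvent_sep_comm [a, b, c] [y]]
  exact sep_crit w y [a, b, c] [a, b] [c] [a] [b] (by simp) (by simp)

/-- Row `23` = `(D[abc|y], D[ab|cy], D[a|b])` on EVERY finite weighted graph (criterion: middle `{y ↮ abc}`). [this work] -/
theorem frontier_23_all (w : Sym2 (Fin n) → unitInterval) (a b c y : Fin n) :
    0 ≤ sahiE3 (prodBernoulli w) (connEvent (row 23 n (a, b, c, y)).1) (connEvent (row 23 n (a, b, c, y)).2.1)
      (connEvent (row 23 n (a, b, c, y)).2.2) := by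
  have hr : row 23 n (a, b, c, y) = (sep [a, b, c] [y], sep [a, b] [c, y], sep [a] [b]) := rfl
  rw [hr]
  rw [sahiE3_comm₁₂]
  rw [connEvent_sep_comm [a, b, c] [y]]
  rw [connEvent_sep_comm [a, b] [c, y]]
  exact sep_crit w y [a, b, c] [c, y] [a, b] [a] [b] (by simp) (by simp)

/-- Row `24` = `(D[abc|y], D[ay|b], D[ay|c])` on EVERY finite weighted graph (criterion: middle `{y ↮ abc}`). [this work] -/
theorem frontier_24_all (w : Sym2 (Fin n) → unitInterval) (a b c y : Fin n) :
    0 ≤ sahiE3 (prodBernoulli w) (connEvent (row 24 n (a, b, c, y)).1) (connEvent (row 24 n (a, b, c, y)).2.1)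
      (connEvent (row 24 n (a, b, c, y)).2.2) := by
  have hr : row 24 n (a, b, c, y) = (sep [a, b, c] [y], sep [a, y] [b], sep [a, y] [c]) := rfl
  rw [hr]
  rw [sahiE3_comm₁₂]
  rw [connEvent_sep_comm [a, b, c] [y]]
  exact sep_crit w y [a, b, c] [a, y] [b] [a, y] [c] (by simp) (by simp)

/-- Row `25` = `(D[abc|y], D[ay|b], D[b|cy])` on EVERY finite weighted graph (criterion: middle `{y ↮ abc}`). [this work] -/
theorem frontier_25_all (w : Sym2 (Fin n) → unitInterval) (a b c y : Fin n) :
    0 ≤ sahiE3 (prodBernoulli w) (connEvent (row 25 n (a, b, c, y)).1) (connEvent (row 25 n (a, b, c, y)).2.1)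
      (connEvent (row 25 n (a, b, c, y)).2.2) := by
  have hr : row 25 n (a, b, c, y) = (sep [a, b, c] [y], sep [a, y] [b], sep [b] [c, y]) := rfl
  rw [hr]
  rw [sahiE3_comm₁₂]
  rw [connEvent_sep_comm [a, b, c] [y]]
  rw [connEvent_sep_comm [b] [c, y]]
  exact sep_crit w y [a, b, c] [a, y] [b] [c, y] [b] (by simp) (by simp)

/-- Row `26` = `(D[abc|y], D[a|b], D[a|c])` on EVERY finite weighted graph (criterion: middle `{y ↮ abc}`). [this work] -/
theorem frontier_26_all (w : Sym2 (Fin n) → unitInterval) (a b c y : Fin n) :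
    0 ≤ sahiE3 (prodBernoulli w) (connEvent (row 26 n (a, b, c, y)).1) (connEvent (row 26 n (a, b, c, y)).2.1)
      (connEvent (row 26 n (a, b, c, y)).2.2) := by
  have hr : row 26 n (a, b, c, y) = (sep [a, b, c] [y], sep [a] [b], sep [a] [c]) := rfl
  rw [hr]
  rw [sahiE3_comm₁₂]
  rw [connEvent_sep_comm [a, b, c] [y]]
  exact sep_crit w y [a, b, c] [a] [b] [a] [c] (by simp) (by simp)

/-- Row `28` = `(D[ab|c], D[ac|b], D[a|y])` on EVERY finite weighted graph (criterion: middle `{c ↮ ab}`). [this work] -/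
theorem frontier_28_all (w : Sym2 (Fin n) → unitInterval) (a b c y : Fin n) :
    0 ≤ sahiE3 (prodBernoulli w) (connEvent (row 28 n (a, b, c, y)).1) (connEvent (row 28 n (a, b, c, y)).2.1)
      (connEvent (row 28 n (a, b, c, y)).2.2) := by
  have hr : row 28 n (a, b, c, y) = (sep [a, b] [c], sep [a, c] [b], sep [a] [y]) := rfl
  rw [hr]
  rw [sahiE3_comm₁₂]
  rw [connEvent_sep_comm [a, b] [c]]
  rw [connEvent_sep_comm [a] [y]]
  exact sep_crit w c [a, b] [a, c] [b] [y] [a] (by simp) (by simp)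

/-- Row `29` = `(D[ab|c], D[ac|b], D[bc|y])` on EVERY finite weighted graph (criterion: middle `{y ↮ bc}`). [this work] -/
theorem frontier_29_all (w : Sym2 (Fin n) → unitInterval) (a b c y : Fin n) :
    0 ≤ sahiE3 (prodBernoulli w) (connEvent (row 29 n (a, b, c, y)).1) (connEvent (row 29 n (a, b, c, y)).2.1)
      (connEvent (row 29 n (a, b, c, y)).2.2) := by
  have hr : row 29 n (a, b, c, y) = (sep [a, b] [c], sep [a, c] [b], sep [b, c] [y]) := rfl
  rw [hr]
  rw [sahiE3_comm₂₃]
  rw [connEvent_sep_comm [b, c] [y]]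
  exact sep_crit w y [b, c] [a, b] [c] [a, c] [b] (by simp) (by simp)

/-- Row `34` = `(D[ab|c], D[a|cy], D[b|y])` on EVERY finite weighted graph (criterion: middle `{c ↮ ab}`). [this work] -/
theorem frontier_34_all (w : Sym2 (Fin n) → unitInterval) (a b c y : Fin n) :
    0 ≤ sahiE3 (prodBernoulli w) (connEvent (row 34 n (a, b, c, y)).1) (connEvent (row 34 n (a, b, c, y)).2.1)
      (connEvent (row 34 n (a, b, c, y)).2.2) := by
  have hr : row 34 n (a, b, c, y) = (sep [a, b] [c], sep [a] [c, y], sep [b] [y]) := rfl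
  rw [hr]
  rw [sahiE3_comm₁₂]
  rw [connEvent_sep_comm [a, b] [c]]
  rw [connEvent_sep_comm [a] [c, y]]
  rw [connEvent_sep_comm [b] [y]]
  exact sep_crit w c [a, b] [c, y] [a] [y] [b] (by simp) (by simp)

/-- Row `35` = `(D[ab|c], D[a|y], D[b|y])` on EVERY finite weighted graph (criterion: middle `{c ↮ ab}`). [this work] -/
theorem frontier_35_all (w : Sym2 (Fin n) → unitInterval) (a b c y : Fin n) :
    0 ≤ sahiE3 (prodBernoulli w) (connEvent (row 35 n (a, b, c, y)).1) (connEvent (row 35 n (a, b, c, y)).2.1)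
      (connEvent (row 35 n (a, b, c, y)).2.2) := by
  have hr : row 35 n (a, b, c, y) = (sep [a, b] [c], sep [a] [y], sep [b] [y]) := rfl
  rw [hr]
  rw [sahiE3_comm₁₂]
  rw [connEvent_sep_comm [a, b] [c]]
  rw [connEvent_sep_comm [a] [y]]
  rw [connEvent_sep_comm [b] [y]]
  exact sep_crit w c [a, b] [y] [a] [y] [b] (by simp) (by simp)

/-- Row `38` = `(D[abc|y], D[aby|c], D[a|b])` on EVERY finite weighted graph (criterion: middle `{y ↮ abc}`). [this work] -/
theorem frontier_38_all (w : Sym2 (Fin n) → unitInterval) (a b c y : Fin n) :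
    0 ≤ sahiE3 (prodBernoulli w) (connEvent (row 38 n (a, b, c, y)).1) (connEvent (row 38 n (a, b, c, y)).2.1)
      (connEvent (row 38 n (a, b, c, y)).2.2) := by
  have hr : row 38 n (a, b, c, y) = (sep [a, b, c] [y], sep [a, b, y] [c], sep [a] [b]) := rfl
  rw [hr]
  rw [sahiE3_comm₁₂]
  rw [connEvent_sep_comm [a, b, c] [y]]
  exact sep_crit w y [a, b, c] [a, b, y] [c] [a] [b] (by simp) (by simp)

/-- Row `39` = `(D[ab|c], D[ab|y], D[a|b])` on EVERY finite weighted graph (criterion: middle `{c ↮ ab}`). [this work] -/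
theorem frontier_39_all (w : Sym2 (Fin n) → unitInterval) (a b c y : Fin n) :
    0 ≤ sahiE3 (prodBernoulli w) (connEvent (row 39 n (a, b, c, y)).1) (connEvent (row 39 n (a, b, c, y)).2.1)
      (connEvent (row 39 n (a, b, c, y)).2.2) := by
  have hr : row 39 n (a, b, c, y) = (sep [a, b] [c], sep [a, b] [y], sep [a] [b]) := rfl
  rw [hr]
  rw [sahiE3_comm₁₂]
  rw [connEvent_sep_comm [a, b] [c]]
  rw [connEvent_sep_comm [a, b] [y]]
  exact sep_crit w c [a, b] [y] [a, b] [a] [b] (by simp) (by simp)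

/-- Row `41` = `(D[abc|y], D[aby|c], D[acy|b])` on EVERY finite weighted graph (criterion: middle `{y ↮ abc}`). [this work] -/
theorem frontier_41_all (w : Sym2 (Fin n) → unitInterval) (a b c y : Fin n) :
    0 ≤ sahiE3 (prodBernoulli w) (connEvent (row 41 n (a, b, c, y)).1) (connEvent (row 41 n (a, b, c, y)).2.1)
      (connEvent (row 41 n (a, b, c, y)).2.2) := by
  have hr : row 41 n (a, b, c, y) = (sep [a, b, c] [y], sep [a, b, y] [c], sep [a, c, y] [b]) := rfl
  rw [hr]
  rw [sahiE3_comm₁₂]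
  rw [connEvent_sep_comm [a, b, c] [y]]
  exact sep_crit w y [a, b, c] [a, b, y] [c] [a, c, y] [b] (by simp) (by simp)

/-- Bridge to the `cval`/`terms` (term-family) form of `frontier_le_five`: a row inequality in `sahiE3` form gives the term form,
so each `frontier_i_all` above is also `0 ≤ cval w (terms i n (a, b, c, y))` for every `n`. [this work] -/
theorem cval_terms_nonneg_of_sahiE3 (i : Fin 45) (w : Sym2 (Fin n) → unitInterval) (a b c y : Fin n)
    (h : 0 ≤ sahiE3 (prodBernoulli w) (connEvent (row i n (a, b, c, y)).1) (connEvent (row i n (a, b, c, y)).2.1)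
      (connEvent (row i n (a, b, c, y)).2.2)) :
    0 ≤ cval w (terms i n (a, b, c, y)) := by
  unfold terms
  rw [cval_e3Terms]
  exact h

/-- Example of the bridge: row `0` in term form, all `n`. [this work] -/
theorem frontier_0_cval_all (w : Sym2 (Fin n) → unitInterval) (a b c y : Fin n) : 0 ≤ cval w (terms 0 n (a, b, c, y)) :=
  cval_terms_nonneg_of_sahiE3 0 w a b c y (frontier_0_all w a b c y)

end Summit.CriticalPhenomena.PercolationContinuityZ3.Theorems.FrontierDecRows
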